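import Literature.AnabelianGeometry.EtaleTheta.Discharge.Sec5Prop55EtaTautological
import Literature.AnabelianGeometry.EtaleTheta.Discharge.Sec5RootCocycleDiesOnBN
import HarnessLib

/-!
# [EtTh] Prop. 5.5 proof p.327 (PDF p.101) + Def. 4.1 (iii) p.313 (PDF p.87) — sub-node **EtTh:Prop5.5/P55-L02**, the
# `η`-side binder `hdies` of the carrier closer DISCHARGED BY NAME through the two printed saturation clauses (proof-only)

Mochizuki, *The étale theta function and its Frobenioid-theoretic manifestations*, Publ. RIMS **45** (2009).
abc-iut cell, layer L2, plan/L2/SUBDAG-EtTh-Thm56.md leaf P55-L02; GAP-LEDGER rows G-w5d123-1 (binder `hdies` of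
abc-iut-w5-d123's `ThetaFrobenioid.exists_eta_etaTautological_ofBiKummerData`, p418694) and its two printed leaves
G-L6t23-1 / G-L6t23-2 (abc-iut-L6-t23's `ThetaEnvData.dies_on_ker_of`, p418773).  PROOF-ONLY glue (no `def`, no new
named fact): one kernel edge G-w5d123-1 → {G-L6t23-1, G-L6t23-2}.

THE EDGE.  At the §5 carrier `𝔉 := ThetaFrobenioid.ofBiKummerData …` over a §2 `RigidData RD` (`Π^tp_X̲̲ := RD.PiX`,
`Π^tp_Ÿ̲̲ := RD.PiYdd`, `ρ := rhoOfBiKummerData R ιX : Π^tp_X̲̲ →* Aut_D(B_N^bs)`, `H_{B_N} = ρ(Π^tp_Ÿ̲̲)`), the closer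
p418694 produces a descended `η : H_{B_N} → (l·Δ_Θ)_{B_N} ⊗ ℤ/Nℤ` with `EtaTautological 𝔉 P η` from a mod-`N` theta
cocycle `η₀` PROVIDED `hdies : η₀` dies on `Ker ρ ∩ Π^tp_Ÿ̲̲` («`B_N` is an `l·N`-codomain», Prop. 5.2 (i)/(iii)).  In
print `hdies` holds because `A_N` is `(N, H_⊙, f)`-saturated (Def. 4.1 (iii), p.313): (D1) the base field of `A_N`
contains `μ_N`, so `Π_{A_N^bs} = Ker ρ` acts trivially on `μ_N ≅ (l·Δ_Θ) ⊗ ℤ/Nℤ` ([FrdII] Def. 2.2 (ii)(a)); (D2)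
`f|_{A_N}` admits an `N`-th root, so by Kummer theory each mod-`N` theta cocycle is a coboundary on `Ker ρ ∩ Π^tp_Ÿ̲̲`
(Def. 4.1 (iii)(b)); and abc-iut-L6-t23's `dies_on_ker_of` is exactly «(D1) + (D2) ⇒ `hdies`».  This file composes the
two BY NAME:

* `ThetaFrobenioid.exists_eta_etaTautological_ofBiKummerData_of_saturation` — P55-L02 at the carrier with the
  `η`-side trust base = {(D1) `hD1`, (D2) `hD2`} (both printed clauses of Def. 4.1 (iii), entering as named binders,
  never asserted) and the row-2 laws `hlift`/`hP` of the subquotient datum (GAP-LEDGER G-w5d123-2) unchanged.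

HONEST FRAMING: conditional glue — nothing is discharged beyond the composition; [EtTh] is refereed; typed ≠ proved;
no side is taken on any disputed claim downstream ([IUTchIII] Cor. 3.12).
-/

noncomputable section

namespace Literature.AnabelianGeometry.EtaleTheta

open CategoryTheory FrobenioidCyclotomicRigidity Literature.AlgebraicGeometry.Frobenioids

universe u₀ v₀ u v w

namespace ThetaFrobenioid

variable {K : Type u₀} [Field K]
  {X : SemiGraphs.TemperedArithmeticGroup.{u₀} K} {D₀ : Type u₀} [Category.{v₀} D₀]
  {V : FrdIMonoidStub.{w}} {T₀ : RealifiedDivisorMonoids (D₀ := D₀) V} {D : Type u} [Category.{v} D]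
  {VD : FrdICatStub.{u, v, w} D} {S : BiKummerSetting X T₀ D VD}
  {pullFrac : ∀ {A A' : S.C} (_ : A' ⟶ A), S.biratUnits A → S.biratUnits A'}
  {lv N : ℕ+} {l' : ℕ} {RD : RigidData.{max v w} N l'} {θ : S.biratUnits S.Aodot} {Bl : S.C}
  {Pl : S.FractionPair θ Bl} {Rl : S.NthRoot θ Pl lv pullFrac}
  (h : ModelFrobenioid.Hypotheses S.tf.divisorMonoid S.tf.ratFnFunctor)
  (toB : ∀ A : S.C, S.biratUnits A →* S.tf.biratUnitsModel A) (Q : FrobenioidTheta.ThetaSubquotientStub.{w} D)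
  (odd_l : Odd (lv : ℕ)) (R : S.NthRoot Rl.root Rl.pair N pullFrac) (ιX : RD.PiX ≃ₜ* X.Pi)
  (hopen : IsOpen ((S.galoisSurj R.AN.base R.αData.isGalois).ker : Set X.Pi)) (σ : Aut R.AN.base →* Aut R.AN)
  (K' : Type w) [Field K'] (constEmb : K'ˣ →* S.tf.biratUnitsModel R.BN)
  (constEmb_injective : Function.Injective constEmb)
  (hdivc : ∀ g : Aut R.BN.base,
    ModelFrobenioid.div ((σ ((BiKummerSetting.NthRoot.baseIso S R).conjAut.symm g)).hom ≫ R.pair.num) =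
      ModelFrobenioid.div R.pair.num)
  (hdivp : ∀ y : RD.PiYdd,
    ModelFrobenioid.div ((σ (S.galoisSurj R.AN.base R.αData.isGalois (ιX y.1))).hom ≫ R.pair.den) =
      ModelFrobenioid.div R.pair.den)

/-- **EtTh:Prop5.5/P55-L02 at the carrier, `η`-side from the saturation clauses of Def. 4.1 (iii)**: for the §5 data
`𝔉 := ofBiKummerData …` over a §2 `RigidData` and a mod-`N` theta cocycle `η₀`, IF (D1) `Ker ρ ∩ Π^tp_Ÿ̲̲` acts
trivially on `μ_N` (Def. 4.1 (iii)(a): the base field of `A_N` is `μ_N`-saturated) and (D2) every mod-`N` theta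
cocycle is, on `Ker ρ ∩ Π^tp_Ÿ̲̲`, a coboundary (Def. 4.1 (iii)(b): `f|_{A_N}` has an `N`-th root, read through Kummer
theory) — so that `η₀` dies on `Ker ρ ∩ Π^tp_Ÿ̲̲` by abc-iut-L6-t23's `ThetaEnvData.dies_on_ker_of` — and the subquotient
datum `P` satisfies the row-2 laws `hlift`, `hP`, THEN there is an `η : H_{B_N} → (l·Δ_Θ)_{B_N} ⊗ ℤ/Nℤ` descending `η₀`
through `e` which is tautological on the `(l·Δ_Θ)_{B_N}`-part: `EtaTautological 𝔉 P η`.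
[cite: MochizukiEtTh2009, Prop 5.5 proof p.327 (PDF p.101); Def 4.1 (iii) p.313 (PDF p.87)] -/
theorem exists_eta_etaTautological_ofBiKummerData_of_saturation
    {η₀ : RD.PiYdd → RD.mu} (hη₀ : η₀ ∈ RD.thetaCocycles)
    (hD1 : ∀ k : RD.PiYdd, rhoOfBiKummerData R ιX (k : RD.PiX) = 1 →
      RD.chi (RD.aug (k : RD.PiX)) = 1)
    (hD2 : ∀ η ∈ RD.thetaCocycles, ∃ c : RD.mu, ∀ k : RD.PiYdd, rhoOfBiKummerData R ιX (k : RD.PiX) = 1 →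
      η k = CycEnvelope.coboundary (RD.aug.comp RD.PiYdd.subtype) RD.chi c k)
    (e : RD.mu → (ofBiKummerData h toB Q odd_l R ιX hopen σ K' constEmb constEmb_injective hdivc hdivp).lDeltaModN
      (ofBiKummerData h toB Q odd_l R ιX hopen σ K' constEmb constEmb_injective hdivc hdivp).BN)
    (P : ThetaSubquotientProj (ofBiKummerData h toB Q odd_l R ιX hopen σ K' constEmb constEmb_injective hdivc hdivp))
    (hlift : ∀ a ∈ (ofBiKummerData h toB Q odd_l R ιX hopen σ K' constEmb constEmb_injective hdivc hdivp).HB,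
      a ∈ P.pre _ → ∃ k : RD.PiYdd, (k : RD.PiX) ∈ RD.lDeltaTheta ∧ rhoOfBiKummerData R ιX k = a)
    (hP : ∀ (k : RD.PiYdd) (hk : (k : RD.PiX) ∈ RD.lDeltaTheta) (hm : rhoOfBiKummerData R ιX k ∈ P.pre _),
      (QuotientGroup.mk (P.proj _ ⟨rhoOfBiKummerData R ιX k, hm⟩) :
          (ofBiKummerData h toB Q odd_l R ιX hopen σ K' constEmb constEmb_injective hdivc hdivp).lDeltaModN
            (ofBiKummerData h toB Q odd_l R ιX hopen σ K' constEmb constEmb_injective hdivc hdivp).BN) =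
        e (RD.thetaMod ⟨k, hk⟩)) :
    ∃ η : (ofBiKummerData h toB Q odd_l R ιX hopen σ K' constEmb constEmb_injective hdivc hdivp).HB →
        (ofBiKummerData h toB Q odd_l R ιX hopen σ K' constEmb constEmb_injective hdivc hdivp).lDeltaModN
          (ofBiKummerData h toB Q odd_l R ιX hopen σ K' constEmb constEmb_injective hdivc hdivp).BN,
      (∀ k : RD.PiYdd, η ⟨rhoOfBiKummerData R ιX k, Subgroup.mem_map_of_mem _ k.2⟩ = e (η₀ k)) ∧
      Thm56Sub.EtaTautological (ofBiKummerData h toB Q odd_l R ιX hopen σ K' constEmb constEmb_injective hdivc hdivp)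
        P η :=
  exists_eta_etaTautological_ofBiKummerData h toB Q odd_l R ιX hopen σ K' constEmb constEmb_injective hdivc hdivp hη₀
    (RD.toThetaEnvData.dies_on_ker_of (rhoOfBiKummerData R ιX) hD1 hD2 η₀ hη₀) e P hlift hP

end ThetaFrobenioid

end Literature.AnabelianGeometry.EtaleTheta

end
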